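import Literature.Algebra.Homology.ExtPresentationBoundary
import HarnessLib

/-!
# `Ext²(N, X₁)` through a presentation `0 → N₁ → P → N → 0` and a coefficient sequence
# `0 → X₁ → X₂ → X₃ → 0`: the degree-`2` OBSTRUCTION `Hom(N₁, X₃) → Ext²(N, X₁)` of a homomorphism,
# its kernel (homomorphisms lifting to `X₂`) when `Ext¹(P, X₁) = 0` — the second half of the
# `Hom`-level chase behind Milne's proof of *ADT* I Thm. 4.10 (a)

Topic `Algebra/Homology`; namespace `Literature.Algebra.Homology.ExtPresentation`.  Sequel of
`ExtPresentationBoundary` (door-c6 g16: `boundary hS X : Hom(N₁, X) →+ Ext¹(N, X)` and the degree-`1` chase).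
One definition with body (`obstruction`, an `AddMonoidHom`) and theorems, for Mathlib's `Abelian.Ext` in any
abelian category with `HasExt`; no named fact, no instance, no `sorry`.

THE MATHEMATICS (Cartan–Eilenberg / Weibel: dimension shifting in both variables).  Let
`S : 0 → N₁ —ι→ P —π→ N → 0` ("presentation of `N`") and `T : 0 → X₁ —f→ X₂ —g→ X₃ → 0` ("coefficients") be
short exact.  For a homomorphism `h : N₁ → X₃` put
**`Ψ(h) := [S] ∘ h ∘ [T] ∈ Ext²(N, X₁)`** — the Yoneda product of the class `[T] ∈ Ext¹(X₃, X₁)` (the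
obstruction `∂_T h = h ∘ [T] ∈ Ext¹(N₁, X₁)` to lifting `h` along `g`) with the class `[S] ∈ Ext¹(N, N₁)`
(dimension shift `Ext¹(N₁, ·) → Ext²(N, ·)`).  Then:
* `Ψ` is additive (`obstruction`), `Ψ(u ≫ g) = 0` for `u : N₁ → X₂` (`obstruction_comp_g`: `g ∘ [T] = 0`) and
  `Ψ(ι ≫ q) = 0` for `q : P → X₃` (`obstruction_f_comp`: `[S] ∘ ι = 0`);
* **if `Ext¹(P, X₁) = 0` then `Ψ(h) = 0` iff `h` lifts along `g`** (`exists_comp_g_eq_of_obstruction_eq_zero`,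
  `obstruction_eq_zero_iff`): `[S] ∘ (h ∘ [T]) = 0` forces `h ∘ [T] ∈ ι^* Ext¹(P, X₁) = 0` (contravariant
  exactness at `Ext¹(N₁, X₁)`), and `h ∘ [T] = 0` iff `h = u ≫ g` (covariant exactness at `Hom(N₁, X₃)`);
* `Ψ(h) ∘ [π] = 0`, i.e. `Ψ` lands in the kernel of `Ext²(N, X₁) → Ext²(P, X₁)` (`mk₀_g_comp_obstruction`), and
  `Ψ(h) ∘ f = 0` in `Ext²(N, X₂)` (`obstruction_comp_mk₀_f`).
So, when `Ext¹(P, X₁) = 0`, `Ψ` embeds `Hom(N₁, X₃) / g_* Hom(N₁, X₂)` into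
`Ker(Ext²(N, X₁) → Ext²(P, X₁)) ∩ Ker(Ext²(N, X₁) → Ext²(N, X₂))`.

USE (Route "Ш²-readout" of cell `bsd-wall`, seat chl-p2 g6, toward Milne I Thm. 4.10 (a) = the named fact
`poitouTate_sha_tateDual`, item stmt-BirchSwinnertonDyer-20462): `S` = door-c4's free presentation
`0 → N₁ → Inf ℤ[Γ/U]ᵐ → M → 0`, `T` = door-c5's `0 → F̄ˣ → J̄ → C̄ → 0`; `Ψ : Hom_{C_Γ}(N₁, C̄) → Ext²_{C_Γ}(M, F̄ˣ)
≅ H²(K, Hom(M, K̄ˣ)) = H²(K, M^D)` is the degree-`2` obstruction map of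
`PoitouTateShaTwoReadout.shaTwo_tateDual_of_presentation_readout`, and this file supplies three of its five
properties ((a) `Ψ(f ≫ g) = 0`, (b) `Ψ(ι ≫ q) = 0`, (c) `Ψ h = 0 ⟹ h = f ≫ g`; Hilbert 90 gives
`Ext¹(Inf ℤ[Γ/U]ᵐ, F̄ˣ) = 0`).
HONEST FRAMING: homological algebra only; no arithmetic statement is proved here.

## References
* C. A. Weibel, *An introduction to homological algebra* (1994), §2.7 (dimension shifting), Thm. 2.7.6,
  §3.4 (Yoneda `Ext`, Vista 3.4.6). [Weibel1994]
* J. S. Milne, *Arithmetic Duality Theorems* (2nd ed. 2006), I §0 (0.8)–(0.11), I §4 proof of Theorem 4.10 (a)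
  (p. 58: `Ш²(K, M) = Ker(Ext²(M^D, K̄ˣ) → Ext²(M^D, J̄)) ≅ Coker(Ext¹(M^D, J̄) → Ext¹(M^D, C̄))`). [MilneADT2006]
-/

noncomputable section

universe w v u

namespace Literature.Algebra.Homology

namespace ExtPresentation

open CategoryTheory CategoryTheory.Abelian

variable {C : Type u} [Category.{v} C] [Abelian C] [HasExt.{w} C]
  {S : ShortComplex C} (hS : S.ShortExact) {T : ShortComplex C} (hT : T.ShortExact)

/-! ## §1 The obstruction `Ψ : Hom(N₁, X₃) →+ Ext²(N, X₁)` -/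

/-- **The degree-`2` obstruction `Ψ(h) = [S] ∘ h ∘ [T] ∈ Ext²(N, X₁)` of a homomorphism `h : N₁ → X₃`**
(`[T] ∈ Ext¹(X₃, X₁)` the class of the coefficient sequence, `[S] ∈ Ext¹(N, N₁)` the class of the presentation),
as an additive map. [cite: Weibel1994, §2.7 and §3.4][cite: MilneADT2006, I Theorem 4.10 (proof)] -/
def obstruction : (S.X₁ ⟶ T.X₃) →+ Ext S.X₃ T.X₁ 2 :=
  AddMonoidHom.mk' (fun h => hS.extClass.comp ((Ext.mk₀ h).comp hT.extClass (zero_add 1)) (rfl : 1 + 1 = 2))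
    fun h h' => by rw [Ext.mk₀_add, Ext.add_comp, Ext.comp_add]

/-- Unfolding: `Ψ(h) = [S] ∘ (h ∘ [T])`. [cite: Weibel1994, §3.4] -/
theorem obstruction_apply (h : S.X₁ ⟶ T.X₃) :
    obstruction hS hT h = hS.extClass.comp ((Ext.mk₀ h).comp hT.extClass (zero_add 1)) (rfl : 1 + 1 = 2) :=
  rfl

/-! ## §2 `Ψ` kills homomorphisms that lift to `X₂` and homomorphisms that extend to `P` -/

/-- **`Ψ(u ≫ g) = 0`** for `u : N₁ → X₂`: `(u ≫ g) ∘ [T] = u ∘ (g ∘ [T]) = 0`.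
[cite: Weibel1994, Theorem 2.7.6][cite: MilneADT2006, I Theorem 4.10 (proof)] -/
theorem obstruction_comp_g (u : S.X₁ ⟶ T.X₂) : obstruction hS hT (u ≫ T.g) = 0 := by
  rw [obstruction_apply, ← Ext.mk₀_comp_mk₀, Ext.comp_assoc_of_second_deg_zero, hT.comp_extClass, Ext.comp_zero,
    Ext.comp_zero]

/-- **`Ψ(ι ≫ q) = 0`** for `q : P → X₃`: `[S] ∘ ι = 0`. [cite: Weibel1994, Theorem 2.7.6] -/
theorem obstruction_f_comp (q : S.X₂ ⟶ T.X₃) : obstruction hS hT (S.f ≫ q) = 0 := by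
  rw [obstruction_apply, ← Ext.mk₀_comp_mk₀, Ext.comp_assoc_of_second_deg_zero,
    ← Ext.comp_assoc_of_second_deg_zero, hS.extClass_comp, Ext.zero_comp]

/-- `Ψ(u ≫ g + ι ≫ q) = 0`. [cite: Weibel1994, Theorem 2.7.6] -/
theorem obstruction_eq_zero_of_eq_add (u : S.X₁ ⟶ T.X₂) (q : S.X₂ ⟶ T.X₃) :
    obstruction hS hT (u ≫ T.g + S.f ≫ q) = 0 := by
  rw [map_add, obstruction_comp_g, obstruction_f_comp, add_zero]

/-! ## §3 The kernel of `Ψ` when `Ext¹(P, X₁) = 0` -/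

/-- **`h ∘ [T] = 0` iff `h` lifts along `g`** (covariant exactness of `Hom(N₁, –)` at `Hom(N₁, X₃)`).
[cite: Weibel1994, Theorem 2.7.6] -/
theorem mk₀_comp_extClass_eq_zero_iff (h : S.X₁ ⟶ T.X₃) :
    (Ext.mk₀ h).comp hT.extClass (zero_add 1) = 0 ↔ ∃ u : S.X₁ ⟶ T.X₂, u ≫ T.g = h := by
  constructor
  · intro h0
    obtain ⟨x₂, hx₂⟩ := Ext.covariant_sequence_exact₃ (hS := hT) (X := S.X₁) (Ext.mk₀ h) (n₁ := 1)
      (zero_add 1) h0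
    refine ⟨Ext.addEquiv₀ x₂, ?_⟩
    apply Ext.addEquiv₀.symm.injective
    change Ext.mk₀ (Ext.addEquiv₀ x₂ ≫ T.g) = Ext.mk₀ h
    rw [← Ext.mk₀_comp_mk₀, Ext.mk₀_addEquiv₀_apply, hx₂]
  · rintro ⟨u, rfl⟩
    rw [← Ext.mk₀_comp_mk₀, Ext.comp_assoc_of_second_deg_zero, hT.comp_extClass, Ext.comp_zero]

include hS in
/-- **If `Ext¹(P, X₁) = 0`, a class of `Ext¹(N₁, X₁)` killed by `[S] ∘ –` vanishes** (contravariant exactness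
`Ext¹(P, X₁) → Ext¹(N₁, X₁) → Ext²(N, X₁)`). [cite: Weibel1994, Theorem 2.7.6] -/
theorem eq_zero_of_extClass_comp_eq_zero (hP : ∀ x : Ext S.X₂ T.X₁ 1, x = 0) (x : Ext S.X₁ T.X₁ 1)
    (hx : hS.extClass.comp x (rfl : 1 + 1 = 2) = 0) : x = 0 := by
  obtain ⟨x₂, hx₂⟩ := Ext.contravariant_sequence_exact₁ (hS := hS) (Y := T.X₁) x (rfl : 1 + 1 = 2) hx
  rw [← hx₂, hP x₂, Ext.comp_zero]

include hS in
/-- **THE DEGREE-2 CHASE.**  If `Ext¹(P, X₁) = 0` and `Ψ(h) = 0`, then `h = u ≫ g` lifts along `g`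
(`[S] ∘ (h ∘ [T]) = 0 ⟹ h ∘ [T] = 0 ⟹ h` lifts).  In Milne's proof of I 4.10 (a) this is the injectivity of
`Coker(Ext¹(M^D, J̄) → Ext¹(M^D, C̄)) → Ext²(M^D, K̄ˣ)`, at the level of equivariant homomorphisms out of the
relation module. [cite: MilneADT2006, I Theorem 4.10 (proof)][cite: Weibel1994, Theorem 2.7.6] -/
theorem exists_comp_g_eq_of_obstruction_eq_zero (hP : ∀ x : Ext S.X₂ T.X₁ 1, x = 0) (h : S.X₁ ⟶ T.X₃)
    (h0 : obstruction hS hT h = 0) : ∃ u : S.X₁ ⟶ T.X₂, u ≫ T.g = h :=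
  (mk₀_comp_extClass_eq_zero_iff hT h).1
    (eq_zero_of_extClass_comp_eq_zero hS hP _ (by rwa [obstruction_apply] at h0))

include hS in
/-- **Kernel of `Ψ` when `Ext¹(P, X₁) = 0`**: `Ψ(h) = 0` iff `h = u ≫ g` for some `u : N₁ → X₂`.
[cite: MilneADT2006, I Theorem 4.10 (proof)][cite: Weibel1994, Theorem 2.7.6] -/
theorem obstruction_eq_zero_iff (hP : ∀ x : Ext S.X₂ T.X₁ 1, x = 0) (h : S.X₁ ⟶ T.X₃) :
    obstruction hS hT h = 0 ↔ ∃ u : S.X₁ ⟶ T.X₂, u ≫ T.g = h := by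
  refine ⟨exists_comp_g_eq_of_obstruction_eq_zero hS hT hP h, ?_⟩
  rintro ⟨u, rfl⟩
  exact obstruction_comp_g hS hT u

include hS in
/-- Two homomorphisms have the same obstruction iff they differ by one that lifts along `g`
(`Ext¹(P, X₁) = 0`). [cite: Weibel1994, Theorem 2.7.6] -/
theorem obstruction_eq_obstruction_iff (hP : ∀ x : Ext S.X₂ T.X₁ 1, x = 0) (h h' : S.X₁ ⟶ T.X₃) :
    obstruction hS hT h = obstruction hS hT h' ↔ ∃ u : S.X₁ ⟶ T.X₂, h = h' + u ≫ T.g := by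
  rw [← sub_eq_zero, ← map_sub, obstruction_eq_zero_iff hS hT hP]
  constructor
  · rintro ⟨u, hu⟩
    exact ⟨u, by rw [hu, add_sub_cancel]⟩
  · rintro ⟨u, hu⟩
    exact ⟨u, by rw [hu, add_sub_cancel_left]⟩

/-! ## §4 Where `Ψ` lands: killed by `π^*` and by `f_*` -/

/-- **`[π] ∘ Ψ(h) = 0` in `Ext²(P, X₁)`**: `Ψ` lands in `Ker(Ext²(N, X₁) → Ext²(P, X₁))`.
[cite: Weibel1994, Theorem 2.7.6] -/
theorem mk₀_g_comp_obstruction (h : S.X₁ ⟶ T.X₃) :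
    (Ext.mk₀ S.g).comp (obstruction hS hT h) (zero_add 2) = 0 := by
  rw [obstruction_apply, ← Ext.comp_assoc (Ext.mk₀ S.g) hS.extClass _ (zero_add 1) rfl (by omega),
    hS.comp_extClass, Ext.zero_comp]

/-- **`Ψ(h) ∘ f = 0` in `Ext²(N, X₂)`**: `Ψ` lands in `Ker(Ext²(N, X₁) → Ext²(N, X₂))` (`[T] ∘ f = 0`).
[cite: Weibel1994, Theorem 2.7.6][cite: MilneADT2006, I Theorem 4.10 (proof)] -/
theorem obstruction_comp_mk₀_f (h : S.X₁ ⟶ T.X₃) :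
    (obstruction hS hT h).comp (Ext.mk₀ T.f) (add_zero 2) = 0 := by
  rw [obstruction_apply, Ext.comp_assoc_of_third_deg_zero, Ext.comp_assoc_of_third_deg_zero, hT.extClass_comp,
    Ext.comp_zero, Ext.comp_zero]

end ExtPresentation

end Literature.Algebra.Homology

end
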